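import Summits.QuantumFields.YangMills.Theorems.FluctuationComparisonRegPrIntLRunpairOrganFibreLawJDefs
import Summits.QuantumFields.YangMills.Theorems.FluctuationComparisonRegPrIntLRunpairOrganFibreLawJSqDefs
import HarnessLib

/-!
# Route `UnitScaleTilt` — crux `FluctuationComparisonRegPrIntL` (stmt-QuantumFields-20520, rung R3), PATH-B organ, sq-programme step (sq1)′: «THE NEAR-PAIR EDITION IS A PURE WEAKENING» —
# `SpreadFibreLawHJ → SpreadFibreLawHJsq` by instantiation (DEFINITION-FREE companion of ✓`…RunpairOrganFibreLawJSqDefs`)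

Cell `ym3-torus` (rung R3 = continuum `SU(2)` Yang–Mills on T³ — NOT d = 4, NOT infinite volume, NOT a mass gap, NOT Clay).  Width seat `ym-ust-20520-w4` (gen 24),
LEAD-20520 w3 g26 RULING №38 (b) ∕ №40 (A); `--kind proof --supports stmt-QuantumFields-20520 --as helper`, count-neutral, default heartbeats, `autoImplicit false`.

WHAT.  ★`spreadFibreLawHJsq_of_HJ : SpreadFibreLawHJ → SpreadFibreLawHJsq` — the formal content of «the sq-edition is obtained by PURE BINDER RESTRICTION»: the common prefix
(heads, letters, chart block [0]–[11], seed binders) is passed through unchanged, and each of the eight clauses of the frozen all-pairs row ✓p814004 is instantiated at the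
corner the sq-text names — (JT-h)∕(JV2-h) at `Xw := Y`, (JV1-h) at `Xw := Y` (the membership hypothesis on `X` discarded), (JV0-h) at the given corner pair (square data and
memberships discarded), (L1ʲ-h)∕(JV3-h′) at `U₂ := V₁`, (L2ʲ-h)∕(JV4-h′) by `id`.  The converse is NOT claimed (and is the far-pair debt of TN-HGLOB-FRAME).

HONEST FRAMING: an implication between two HYPOTHESIS rows; nothing of Bałaban's analysis is asserted or proved; `SpreadFibreLawHJ(sq)` UNDISCHARGED; O1ᵘ-H v2.2, S1aᴴ,
S3ᴴ, S2α′, S2β, the five registered stubs, crux 20520 and `YM3TorusSU2` NOT proved; rung R3 = SU(2) YM₃ on T³ at fixed lattice data — NOT d = 4, NOT infinite volume, NOT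
a mass gap, NOT Clay; the Yang–Mills mass gap is NOT proved.  [folklore] bookkeeping.
-/

set_option autoImplicit false

noncomputable section

namespace Summit.QuantumFields.YangMills.Theorems.OrganTangentSpreadFibreLawHJsqOfHJ

open Summit.QuantumFields.YangMills.Theorems.FluctuationComparisonRegPrIntLRunpairOrganFibreLawJ (SpreadFibreLawHJ)
open Summit.QuantumFields.YangMills.Theorems.FluctuationComparisonRegPrIntLRunpairOrganFibreLawJSq (SpreadFibreLawHJsq)

/-- ★ **THE sq-EDITION IS A PURE WEAKENING**: `SpreadFibreLawHJ → SpreadFibreLawHJsq`, by instantiating every far-quantified law point at the corner the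
sq-text names (`Xw := Y`, `U₂ := V₁`, (JV0-h) at the given corner pair); nothing else moves. [folklore] -/
theorem spreadFibreLawHJsq_of_HJ (hFJ : SpreadFibreLawHJ) : SpreadFibreLawHJsq := by
  obtain ⟨pW, γ₁, hγ₁, h⟩ := hFJ
  refine ⟨pW, γ₁, hγ₁, ?_⟩
  intro F γ hγ hγ1 b₀ p₀ j₀ prm η rA Bρ hb₀ hp₀ hpW hadm hη0 hηs hηss hηt hrA
  obtain ⟨κ₀, hκ₀, h⟩ := h F γ hγ hγ1 b₀ p₀ j₀ prm η rA Bρ hb₀ hp₀ hpW hadm hη0 hηs hηss hηt hrA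
  refine ⟨κ₀, hκ₀, ?_⟩
  intro κ hκ hκle
  obtain ⟨rc, w₀, NT, NX, NL, CJ, NV1, NV2, NV3, NV4, δT, δX, δL, δV1, δV2, δV3, δV4, j₁, hrc, hw₀, hNT, hNX, hNL, hCJ, hδ0,
    hδTs, hδTss, hδTt, hδXs, hδXss, hδXt, hδLs, hδLss, hδLt, hV, hj₁, h⟩ := h κ hκ hκle
  refine ⟨rc, w₀, NT, NX, NL, CJ, NV1, NV2, NV3, NV4, δT, δX, δL, δV1, δV2, δV3, δV4, j₁, hrc, hw₀, hNT, hNX, hNL, hCJ, hδ0,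
    hδTs, hδTss, hδTt, hδXs, hδXss, hδXt, hδLs, hδLss, hδLt, hV, hj₁, ?_⟩
  intro ν hG hCν K K' hKK' Ts T hTs hTK μ μ' ρ ρ' hanch hcut hcons hfin hwin j hj1 hjTs
  obtain ⟨Z, instZ, τ, Φ, J, S, π, hτ, hΦm, hJm, hSm, hS, hsec, hdis, hcont, hJle, hpos, hπ1, hπ2, hH, hHV⟩ :=
    h ν hG hCν K K' hKK' Ts T hTs hTK μ μ' ρ ρ' hanch hcut hcons hfin hwin j hj1 hjTs
  refine ⟨Z, instZ, τ, Φ, J, S, π, hτ, hΦm, hJm, hSm, hS, hsec, hdis, hcont, hJle, hpos, hπ1, hπ2, ?_, ?_⟩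
  · -- (H) block: (JT-h) at `Xw := Y`, (L1ʲ-h) at `U₂ := V₁`, (L2ʲ-h) unchanged
    intro k w hw0 hwle hk0 hkrow hksq
    obtain ⟨hJT, hL1, hL2⟩ := hH k w hw0 hwle hk0 hkrow hksq
    refine ⟨?_, ?_, hL2⟩
    · intro t ht0 ht1
      obtain ⟨k', hk'0, hk'row, hA⟩ := hJT t ht0 ht1
      refine ⟨k', hk'0, hk'row, ?_⟩
      intro B B' m m' U V W Y hm hm' hU hV hW hY hVU hVB hWU hWB hYV hYB
      exact hA B B' m m' U V W Y Y hm hm' hU hV hW hY hY hVU hVB hWU hWB hYV hYB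
    · intro t ht0 ht1
      obtain ⟨kX, hkX0, hkXrow, hkXcol, hX⟩ := hL1 t ht0 ht1
      refine ⟨kX, hkX0, hkXrow, hkXcol, ?_⟩
      intro B B' m m' U₁ V₁ W₂ hm hm' hU₁ hV₁ hW₂ hVU hVB hWV hWB
      exact hX B B' m m' U₁ V₁ V₁ W₂ hm hm' hU₁ hV₁ hV₁ hW₂ hVU hVB hWV hWB
  · -- (HV′) block: (JV0-h) at the named corner pair, (JV1-h)/(JV2-h) at `Xw := Y`, (JV3-h′) at `U₂ := V₁`, (JV4-h′) unchanged
    intro k w hw0 hwle hk0 hkrow hksq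
    obtain ⟨hJV0, ⟨kV₁, hkV₁0, hkV₁row, hJV1⟩, ⟨kV₂, hkV₂0, hkV₂row, hJV2⟩, ⟨kV₃, hkV₃0, hkV₃row, hkV₃col, hJV3⟩,
      ⟨kV₄, hkV₄0, hkV₄row, hJV4⟩⟩ := hHV k w hw0 hwle hk0 hkrow hksq
    refine ⟨?_, ⟨kV₁, hkV₁0, hkV₁row, ?_⟩, ⟨kV₂, hkV₂0, hkV₂row, ?_⟩, ⟨kV₃, hkV₃0, hkV₃row, hkV₃col, ?_⟩,
      ⟨kV₄, hkV₄0, hkV₄row, hJV4⟩⟩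
    · intro t ht0 ht1 B B' m m' U V W Y X Xw hm hm' hU hV hW hY hX hXw hVU hVB hWU hWB hYV hYB hXmem hXwmem
      exact hJV0 t ht0 ht1 X Xw hX hXw
    · intro t ht0 ht1 B B' m m' U V W Y X hm hm' hU hV hW hY hX hXmem hVU hVB hWU hWB hYV hYB
      exact hJV1 t ht0 ht1 B B' m m' U V W Y X Y hm hm' hU hV hW hY hX hY hVU hVB hWU hWB hYV hYB
    · intro t ht0 ht1 B B' m m' U V W Y hm hm' hU hV hW hY hVU hVB hWU hWB hYV hYB
      exact hJV2 t ht0 ht1 B B' m m' U V W Y Y hm hm' hU hV hW hY hY hVU hVB hWU hWB hYV hYB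
    · intro t ht0 ht1 B B' m m' U₁ V₁ W₂ hm hm' hU₁ hV₁ hW₂ hVU hVB hWV hWB
      exact hJV3 t ht0 ht1 B B' m m' U₁ V₁ V₁ W₂ hm hm' hU₁ hV₁ hV₁ hW₂ hVU hVB hWV hWB

end Summit.QuantumFields.YangMills.Theorems.OrganTangentSpreadFibreLawHJsqOfHJ

end
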